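import Literature.AlgebraicGeometry.AbelianSchemes.SymplecticLiftGeometricPoints
import Literature.AlgebraicGeometry.AbelianSchemes.LevelStructureOfTorsionBasis
import Literature.AlgebraicGeometry.AbelianSchemes.LevelStructureChangeLevel
import Literature.AlgebraicGeometry.AbelianSchemes.SymplecticLiftChangeLevel
import Literature.AlgebraicGeometry.AbelianSchemes.LevelStructureLiftNilpotent
import Literature.AlgebraicGeometry.AbelianSchemes.AbelianSchemePolarization
import HarnessLib

/-!
# Refinement of symplectic-liftable level structures over an algebraically closed field
# ([Lan2013PELCompactifications] §1.3.6 Def. 1.3.6.2 / Lemma 1.3.6.5; [MumfordFogartyKirwan1994] Ch. 7 §3 p. 139 and App. 7A p. 235)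

Topic `AlgebraicGeometry/AbelianSchemes`; namespace `Literature.AlgebraicGeometry.AbelianSchemes.AbelianSchemeOver`.
THEOREMS ONLY (no definition, no named fact, no instance, no notation, no `sorry`).

[MumfordFogartyKirwan1994, App. 7A (p. 235)] considers the fine moduli schemes «as a tower with respect to finite morphisms
`𝒜_{nm} → 𝒜_n`»; that these level-lowering maps are SURJECTIVE on geometric points is the elementary fact proved here at the
level of one abelian scheme: over an algebraically closed field `K` of characteristic `0`, a level-`N` structure `φ` on an
abelian scheme `A → Spec K` which is symplectic-liftable of type `δ` for a polarisation `λ` ([Lan2013PELCompactifications]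
Def. 1.3.6.2: `φ(s̄)` is the reduction of a symplectic similitude `ẑ^{2g} ⥲ T̂ A_s̄`, the tree's ★ `LevelStructure.SymplecticLift`
tower) admits, for every multiple `N′ = N·d ≠ 0`, a level-`N′` structure `η` with `η.changeLevel N d = φ` (`η(eᵢ)^d = φ(eᵢ)`)
which is again symplectic-liftable of type `δ` for `λ` — READ OFF THE TOWER: `η(eᵢ) := Λ_{N′}(eᵢ)` for a symplectic lift `Λ`
of `φ` at the identity point.

* `LevelStructure.restrictPt_id_injective` — a section of `A → Spec K` is determined by its value at the identity point.
* `LevelStructure.exists_of_torsionBasis_fibreId` — a `ℤ/N`-independent family of `N`-torsion points OF THE IDENTITY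
  FIBRE is the family of values `σᵢ(𝟙)` of a level-`N` structure (★ `LevelStructure.exists_of_torsionBasis` transported
  along ★ `fibreIdIso`).
* `LevelStructure.SymplecticLift.exists_levelStructure_lift_eq` — the level-`N′` layer of a symplectic lift of `φ` at `𝟙` is
  a level-`N′` structure `η` with `η.changeLevel N d = φ`, and the same tower is a symplectic lift of `η` at `𝟙`.
* `LevelStructure.exists_refinement_of_isSymplecticLiftable` — THE HEAD: symplectic-liftable level structures refine along
  `N ∣ N′` (liftability of `η` by ★ `isSymplecticLiftable_of_identityFibre`).

Consumer: ★ `SiegelModuliTower.tr` is surjective on geometric points (`ModuliOfAbelianVarieties/SiegelModuliTowerSurjective`).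
Cell hodgecm-mathlib (D-0151), SOCKETS-F §3 N4 «[MFK94] Lemma 7.11» / Hecke-link road H6′ (B-p14 (g14)); HC_CM is proved only
modulo the 7 printed citations until rung 0 closes; this file discharges none of them.

## References
* [Lan2013PELCompactifications] K.-W. Lan, *Arithmetic compactifications of PEL-type Shimura varieties* (2013), §1.3.6
  Def. 1.3.6.2 (p. 80), Lemma 1.3.6.5 (p. 81).
* [MumfordFogartyKirwan1994] D. Mumford, J. Fogarty, F. Kirwan, *Geometric Invariant Theory*, 3rd ed. (1994), Ch. 7 §2
  Def. 7.1 (p. 129), §3 (p. 139), App. 7A (p. 235).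
* [Deligne1971TravauxShimura] P. Deligne, *Travaux de Shimura* (1971), 4.12 (b) p. 149, 4.16 p. 150.
-/

set_option autoImplicit false

noncomputable section

open CategoryTheory CategoryTheory.Limits AlgebraicGeometry

namespace Literature.AlgebraicGeometry.AbelianSchemes

namespace AbelianSchemeOver

open Literature.AlgebraicGeometry.Motives (AbelianVariety AlgPoints CartierDivisor specOver)

variable {K : Type} [Field K] {A : AbelianSchemeOver (Spec (.of K))}

/-! ### §1 Sections of `A → Spec K` are determined at the identity point -/

/-- **A section of `A → Spec K` is determined by its value at the identity point** `σ(𝟙) ∈ A_𝟙(K)`: the identity-fibre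
isomorphism ★ `fibreIdIso` carries `σ(𝟙)` to the `K`-point underlying `σ` (★ `map_fibreIdIso_restrictPt_id_of_left_eq`).
[cite: MumfordFogartyKirwan1994, Ch. 7 §2 Definition 7.1 (p. 129)] -/
theorem restrictPt_id_injective : Function.Injective (A.restrictPt (𝟙 (Spec (.of K)))) := by
  intro σ τ h
  obtain ⟨P, hP⟩ := exists_point_left_eq A.toAffine.toAbelianVariety σ
  obtain ⟨Q, hQ⟩ := exists_point_left_eq A.toAffine.toAbelianVariety τ
  have hσ : AlgPoints.map (fibreIdIso A).hom.hom.hom.hom (A.restrictPt (𝟙 (Spec (.of K))) σ) = P :=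
    map_fibreIdIso_restrictPt_id_of_left_eq A.toAffine.toAbelianVariety hP.symm
  have hτ : AlgPoints.map (fibreIdIso A).hom.hom.hom.hom (A.restrictPt (𝟙 (Spec (.of K))) τ) = Q :=
    map_fibreIdIso_restrictPt_id_of_left_eq A.toAffine.toAbelianVariety hQ.symm
  have hPQ : P = Q := by rw [← hσ, ← hτ, h]
  exact section_eq_of_left_eq A.toAffine.toAbelianVariety (hP.symm.trans ((congrArg (fun R => R.left) hPQ).trans hQ))

/-- The value at the identity point of the section underlying a `K`-point `P` of `A` is carried back to `P` by the
identity-fibre isomorphism (★ p713965 §5, restated for a general abelian scheme over a field through the definitional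
identity `ofAbelianVariety A.toAffine.toAbelianVariety = A`). [cite: MumfordFogartyKirwan1994, Ch. 7 §2 Definition 7.1 (p. 129)] -/
theorem map_fibreIdIso_restrictPt_id {σ : A.Sections} {P : A.toAffine.toAbelianVariety.Points K}
    (h : σ.left = P.left) :
    AlgPoints.map (fibreIdIso A).hom.hom.hom.hom (A.restrictPt (𝟙 (Spec (.of K))) σ) = P :=
  map_fibreIdIso_restrictPt_id_of_left_eq A.toAffine.toAbelianVariety h

/-! ### §2 The dimension of the generic fibre -/

/-- `dim A_K = g` for an abelian scheme `A → Spec K` of relative dimension `g` (uniqueness of the relative dimension of a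
smooth morphism with non-empty source; ★ `AbelianScheme.isOfRelDim_dim`). [cite: GortzWedhorn2020, Remark 16.54 (p. 539)] -/
theorem dim_toAbelianVariety_of_isOfRelDim {g : ℕ} (h : A.IsOfRelDim g) : A.toAffine.toAbelianVariety.dim = g := by
  have h₂ : SmoothOfRelativeDimension A.toAffine.toAbelianVariety.dim A.toAffine.X.hom := A.toAffine.isOfRelDim_dim
  haveI : Nonempty A.toAffine.X.left := ⟨Motives.AbelianVariety.origin A.toAffine.toAbelianVariety⟩
  exact Motives.AbelianVarietyProofs.eq_of_smoothOfRelativeDimension _ h₂ h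

/-! ### §3 A torsion basis of the identity fibre is a level structure -/

/-- **A `ℤ/N`-independent family of `N`-torsion points of the IDENTITY FIBRE `A_𝟙` is the family of values `σᵢ(𝟙)` of a
level-`N` structure on `A`** (★ `LevelStructure.exists_of_torsionBasis` applied to the points of `A_K` obtained through the
identity-fibre isomorphism ★ `fibreIdIso`, read back by §1). [cite: MumfordFogartyKirwan1994, Ch. 7 §2 Definition 7.1 (p. 129)]
[cite: MumfordAV1970, §6 Application 3 (Proposition p. 64)] -/
theorem LevelStructure.exists_of_torsionBasis_fibreId {g N : ℕ} (hg : A.IsOfRelDim g) (hN : (N : K) ≠ 0)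
    (x : Fin g ⊕ Fin g → (A.fibre (𝟙 (Spec (.of K)))).toAbelianVariety.Points K) (hx : ∀ i, x i ^ N = 1)
    (hinj : Function.Injective fun a : Fin g ⊕ Fin g → ZMod N => ∏ i, x i ^ (a i).val) :
    ∃ η : A.LevelStructure g N, ∀ i, A.restrictPt (𝟙 (Spec (.of K))) (η.σ i) = x i := by
  -- transport the points to `A_K` along the identity-fibre isomorphism (a group homomorphism on points)
  let E : (A.fibre (𝟙 (Spec (.of K)))).toAbelianVariety.Points K →* A.toAffine.toAbelianVariety.Points K :=
    IsMonHom.monoidHom (fibreIdIso A).hom.hom.hom.hom (specOver K K)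
  have hE : ∀ P, E P = AlgPoints.map (fibreIdIso A).hom.hom.hom.hom P := fun P => rfl
  have hEinj : Function.Injective E := A.map_fibreIdIso_hom_injective
  obtain ⟨η, hη⟩ := LevelStructure.exists_of_torsionBasis A.toAffine.toAbelianVariety
    (dim_toAbelianVariety_of_isOfRelDim hg) hN (fun i => E (x i))
    (fun i => by rw [← map_pow, hx, map_one])
    (by
      intro a b hab
      apply hinj
      apply hEinj
      have key : ∀ c : Fin g ⊕ Fin g → ZMod N,
          (List.ofFn fun i : Fin g => E (x (Sum.inl i)) ^ (c (Sum.inl i)).val).prod *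
            (List.ofFn fun i : Fin g => E (x (Sum.inr i)) ^ (c (Sum.inr i)).val).prod = E (∏ i, x i ^ (c i).val) :=
        fun c => by
          rw [map_prod, Fintype.prod_sum_type, List.prod_ofFn, List.prod_ofFn]
          simp only [map_pow]
      have h := hab
      dsimp only at h
      rw [key a, key b] at h
      exact h)
  refine ⟨η, fun i => hEinj ?_⟩
  rw [hE]
  exact map_fibreIdIso_restrictPt_id (hη i)

/-! ### §4 The level-`N′` layer of a symplectic lift is a level structure refining `φ` -/

namespace LevelStructure.SymplecticLift

variable {g N : ℕ} {φ : A.LevelStructure g N}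
  {Θ : CartierDivisor (A.fibre (𝟙 (Spec (.of K)))).toAbelianVariety.X.left} {δ : Fin g → ℕ}
  (Λ : φ.SymplecticLift (𝟙 (Spec (.of K))) Θ δ)

/-- `lift_M (a) = ∏ᵢ lift_M (eᵢ)^{aᵢ}` (the tower maps are homomorphisms on `(ℤ/M)^{2g} = ⊕ ℤ/M · eᵢ`).
[cite: Lan2013PELCompactifications, §1.3.6 Lemma 1.3.6.5 (p. 81)] -/
theorem coe_lift_ofAdd_eq_prod {M : ℕ} [NeZero M] (a : Fin g ⊕ Fin g → ZMod M) :
    ((Λ.lift M (Multiplicative.ofAdd a)) : (A.fibre (𝟙 (Spec (.of K)))).toAbelianVariety.Points K) =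
      ∏ i, ((Λ.lift M (Multiplicative.ofAdd (Pi.single i 1))) :
        (A.fibre (𝟙 (Spec (.of K)))).toAbelianVariety.Points K) ^ (a i).val := by
  have ha : a = ∑ i, (a i).val • (Pi.single i (1 : ZMod M) : Fin g ⊕ Fin g → ZMod M) := by
    funext j
    rw [Finset.sum_apply, Finset.sum_eq_single j (fun i _ hij => by rw [Pi.smul_apply, Pi.single_eq_of_ne hij.symm, smul_zero])
      (fun h => (h (Finset.mem_univ j)).elim), Pi.smul_apply, Pi.single_eq_same, nsmul_eq_mul, mul_one,
      ZMod.natCast_zmod_val]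
  have ha' : Multiplicative.ofAdd a = ∏ i, Multiplicative.ofAdd (Pi.single i (1 : ZMod M)) ^ (a i).val := by
    conv_lhs => rw [ha]
    rw [ofAdd_sum]
    exact Finset.prod_congr rfl fun i _ => ofAdd_nsmul _ _
  set L := ((A.fibre (𝟙 (Spec (.of K)))).toAbelianVariety.torsionPoints K (M : ℤ)).subtype.comp (Λ.lift M) with hL
  change L (Multiplicative.ofAdd a) = ∏ i, L (Multiplicative.ofAdd (Pi.single i 1)) ^ (a i).val
  rw [ha', map_prod]
  exact Finset.prod_congr rfl fun i _ => map_pow L _ _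

/-- **The level-`N′` layer of a symplectic lift of `φ` at the identity point IS a level-`N′` structure `η` refining `φ`**
(`N′ = N·d ≠ 0`, `K` algebraically closed of characteristic `0`): `η(eᵢ)(𝟙) = Λ_{N′}(eᵢ)`, `η.changeLevel N d = φ`
(tower compatibility `Λ_N = [d] ∘ Λ_{N′}` + `Λ_N(eᵢ) = φ(eᵢ)(𝟙)` + §1), and the tower restricted to the levels divisible by
`N′` is a symplectic lift of `η` at `𝟙` for the same witness `Θ`.
[cite: Lan2013PELCompactifications, §1.3.6 Def. 1.3.6.2 (p. 80) and Lemma 1.3.6.5 (p. 81)] [cite: MumfordFogartyKirwan1994, App. 7A (p. 235)] -/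
theorem exists_levelStructure_lift_eq [IsAlgClosed K] (hg : A.IsOfRelDim g) {N' d : ℕ} (hd : N' = N * d)
    (hN'K : (N' : K) ≠ 0) :
    ∃ η : A.LevelStructure g N',
      (∀ i, A.restrictPt (𝟙 (Spec (.of K))) (η.σ i) =
        ((Λ.lift N' (Multiplicative.ofAdd (Pi.single i 1))) : (A.fibre (𝟙 (Spec (.of K)))).toAbelianVariety.Points K)) ∧
      (∀ hN' : N' ≠ 0, η.changeLevel N d hd hN' = φ) ∧ Nonempty (η.SymplecticLift (𝟙 (Spec (.of K))) Θ δ) := by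
  have hN'0 : N' ≠ 0 := by rintro rfl; exact hN'K (by simp)
  have hd0 : d ≠ 0 := by rintro rfl; exact hN'0 (by rw [hd, Nat.mul_zero])
  have hN0 : N ≠ 0 := by rintro rfl; exact hN'0 (by rw [hd, Nat.zero_mul])
  haveI : NeZero N' := ⟨hN'0⟩
  haveI : NeZero N := ⟨hN0⟩
  have hNN' : N ∣ N' := ⟨d, hd⟩
  -- the points `xᵢ := Λ_{N′}(eᵢ)` of the identity fibre
  set x : Fin g ⊕ Fin g → (A.fibre (𝟙 (Spec (.of K)))).toAbelianVariety.Points K := fun i =>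
    ((Λ.lift N' (Multiplicative.ofAdd (Pi.single i 1))) : (A.fibre (𝟙 (Spec (.of K)))).toAbelianVariety.Points K)
    with hxdef
  have hx : ∀ i, x i ^ N' = 1 := fun i => by
    have h := (Λ.lift N' (Multiplicative.ofAdd (Pi.single i 1))).2
    rw [AbelianVariety.mem_torsionPoints_iff, zpow_natCast] at h
    exact h
  have hinj : Function.Injective fun a : Fin g ⊕ Fin g → ZMod N' => ∏ i, x i ^ (a i).val := by
    intro a b hab
    have h : ((Λ.lift N' (Multiplicative.ofAdd a)) : (A.fibre (𝟙 (Spec (.of K)))).toAbelianVariety.Points K) =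
        Λ.lift N' (Multiplicative.ofAdd b) := by
      rw [Λ.coe_lift_ofAdd_eq_prod, Λ.coe_lift_ofAdd_eq_prod]
      exact hab
    exact Multiplicative.ofAdd.injective ((Λ.lift_bijective hNN' hN'0).1 (Subtype.ext h))
  obtain ⟨η, hη⟩ := LevelStructure.exists_of_torsionBasis_fibreId hg hN'K x hx hinj
  refine ⟨η, hη, fun hN' => ?_, ⟨?_⟩⟩
  · -- `η.changeLevel N d = φ`: compare the sections at the identity point
    apply LevelStructure.ext_of_σ_eq
    funext k
    apply restrictPt_id_injective
    rw [LevelStructure.changeLevel_σ, restrictPt_pow, hη k, ← Λ.lift_level k]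
    -- tower compatibility `Λ_N(e_k) = Λ_{d·N}(e_k)^d`, through the index identity `N′ = d·N`
    have hdN : N' = d * N := hd.trans (Nat.mul_comm _ _)
    have hc := Λ.lift_compat d (Pi.single k (1 : ZMod (d * N))) dvd_rfl hN0 hd0
    have hcast : (fun i => ZMod.castHom (Dvd.intro_left d rfl) (ZMod N) ((Pi.single k (1 : ZMod (d * N)) :
        Fin g ⊕ Fin g → ZMod (d * N)) i)) = Pi.single k (1 : ZMod N) := by
      funext i
      by_cases hik : i = k
      · subst hik; rw [Pi.single_eq_same, Pi.single_eq_same, map_one]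
      · rw [Pi.single_eq_of_ne hik, Pi.single_eq_of_ne hik, map_zero]
    rw [hcast] at hc
    have hxk : x k = ((Λ.lift N' (Multiplicative.ofAdd (Pi.single k 1))) :
        (A.fibre (𝟙 (Spec (.of K)))).toAbelianVariety.Points K) := rfl
    rw [hc, hxk, Λ.lift_congr hdN]
    have hfun : (fun j => (ZMod.cast ((Pi.single k (1 : ZMod N') : Fin g ⊕ Fin g → ZMod N') j) : ZMod (d * N))) =
        Pi.single k (1 : ZMod (d * N)) := by
      funext j
      by_cases hjk : j = k
      · subst hjk; rw [Pi.single_eq_same, Pi.single_eq_same, ZMod.cast_one (dvd_of_eq hdN.symm)]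
      · rw [Pi.single_eq_of_ne hjk, Pi.single_eq_of_ne hjk, ZMod.cast_zero]
    rw [hfun]
    rfl
  · -- the same tower is a symplectic lift of `η` at `𝟙`
    exact
      { ζ := Λ.ζ
        isPrimitiveRoot_ζ := fun M hM hM₀ => Λ.isPrimitiveRoot_ζ (dvd_trans hNN' hM) hM₀
        ζ_pow := fun M k hM hM₀ hk => Λ.ζ_pow k (dvd_trans hNN' hM) hM₀ hk
        lift := Λ.lift
        lift_bijective := fun M hM hM₀ => Λ.lift_bijective (dvd_trans hNN' hM) hM₀
        lift_compat := fun M k y hM hM₀ hk => Λ.lift_compat k y (dvd_trans hNN' hM) hM₀ hk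
        lift_level := fun i => (hη i).symm
        pairing := fun M hM hMΩ y z => Λ.pairing (dvd_trans hNN' hM) hMΩ y z }

end LevelStructure.SymplecticLift

/-! ### §5 The head: symplectic-liftable level structures refine -/

/-- **SYMPLECTIC-LIFTABLE LEVEL STRUCTURES REFINE ALONG `N ∣ N′`** (`K` algebraically closed of characteristic `0`,
`N′ ≠ 0`): if `φ` is a level-`N` structure on `A → Spec K`, symplectic-liftable of type `δ` for the polarisation `λ`, then
for every `N′ = N·d` there is a level-`N′` structure `η` with `η.changeLevel N d = φ` which is again symplectic-liftable of
type `δ` for `λ` — [Lan2013PELCompactifications] Def. 1.3.6.2 read at the two levels of one tower `α̂ : ẑ^{2g} ⥲ T̂ A`;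
the geometric-point surjectivity of [MumfordFogartyKirwan1994] App. 7A's «finite morphisms `𝒜_{nm} → 𝒜_n`».  Proof: an ample
`Λ(𝒪(·))`-witness `Θ₁` at the identity point (`Polarization.exists_ample`), a lift `Λ` there (`IsSymplecticLiftable`), §4, and
★ `isSymplecticLiftable_of_identityFibre`. [cite: Lan2013PELCompactifications, §1.3.6 Def. 1.3.6.2 (p. 80) and Lemma 1.3.6.5 (p. 81)]
[cite: MumfordFogartyKirwan1994, App. 7A (p. 235)] [cite: Deligne1971TravauxShimura, 4.12 (b) p. 149 and 4.16 p. 150] -/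
theorem LevelStructure.exists_refinement_of_isSymplecticLiftable [IsAlgClosed K] [CharZero K] {g N : ℕ}
    (hg : A.IsOfRelDim g) {D : A.DualPair} (pol : A.Polarization D) {δ : Fin g → ℕ} (φ : A.LevelStructure g N)
    (hφ : φ.IsSymplecticLiftable pol δ) {N' d : ℕ} (hd : N' = N * d) (hN' : N' ≠ 0) :
    ∃ η : A.LevelStructure g N', η.changeLevel N d hd hN' = φ ∧ η.IsSymplecticLiftable pol δ := by
  obtain ⟨Θ₁, hΘ₁, h₁⟩ := pol.exists_ample K (𝟙 (Spec (.of K)))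
  obtain ⟨Λ⟩ := hφ K (𝟙 (Spec (.of K))) Θ₁ hΘ₁ h₁
  have hN'K : (N' : K) ≠ 0 := Nat.cast_ne_zero.2 hN'
  obtain ⟨η, -, hηφ, hΛ'⟩ := Λ.exists_levelStructure_lift_eq hg hd hN'K
  exact ⟨η, hηφ hN', LevelStructure.isSymplecticLiftable_of_identityFibre D pol h₁ hΛ'⟩

end AbelianSchemeOver

end Literature.AlgebraicGeometry.AbelianSchemes

end
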